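import Mathlib
import Summits.QuantumFields.Balaban3D.Carriers.Regions
import Summits.QuantumFields.Balaban3D.Proofs.Run3Collar
import Summits.QuantumFields.Balaban3D.Proofs.TorusLift

/-!
# `Summit.QuantumFields.Balaban3D.Proofs.AdmissibleRegions` — lane «pub-balaban3d» (Bałaban, CMP **102** (1985) 255–275, d = 3 lattice
# UV stability AS PRINTED), prover seat p2: ADMISSIBLE histories (seat p1's `Carriers.Regions.Hist.Admissible`: every recorded `P_j`
# lies in `Λ_j`) — the covers of recorded plaquettes of different scales are disjoint, and a fine site is covered by at most four
# scale-`j` plaquettes of a given orientation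

HONEST FRAMING (lane PLAN.md §0).  Nothing of [B10] = [Balaban1985UV3] is asserted; bookkeeping over p1's regions `Ω_j(h)` ((38)–(39)
p. 266 taken as definitions): `Omega_antitone` (the regions decrease in the scale index), `admissible_castLE` (truncations stay
admissible), `plaqCover_subset_of_admissible` / `scale_eq_of_mem_plaqCover` (p. 273 L14 «a plaquette p′ ⊂ Λ_j»: covers of recorded
plaquettes of different scales are disjoint), `card_sources_le_four` (the four corners).  Used by `…Proofs.Run3SmallFactors` for the
multiplicity of the regions `Δ′` of (69)–(71).
-/

namespace Summit.QuantumFields.Balaban3D.Proofs.AdmissibleRegions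

open Literature.MathematicalPhysics.QuantumFieldTheory.Balaban1983to89
open Summit.QuantumFields.Balaban3D.Carriers
open Summit.QuantumFields.Balaban3D.Proofs.Run3Collar (Omega_castLE)
open Finset

/-! ## §1 Admissible histories: covers of different scales are disjoint; at most four sources per scale -/

section Admissible

variable {P : Params} (M₁ : ℕ) (Rcol : ℕ → ℕ)

/-- The regions decrease in the scale index: `Ω_{i′}(h) ⊆ Ω_i(h)` for `i ≤ i′ ≤ k`. [cite: Balaban1985UV3, (38) p.266] -/
theorem Omega_antitone : ∀ (k : ℕ) (h : Hist P k) (i i' : ℕ), i ≤ i' → i' ≤ k →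
    Omega M₁ Rcol k h i' ⊆ Omega M₁ Rcol k h i := by
  intro k
  induction k with
  | zero => intro h i i' _ hi'; have : i' = 0 := by omega
            have : i = 0 := by omega
            subst_vars; exact le_rfl
  | succ k ih =>
    intro h i i' hii' hi'
    rcases Nat.eq_or_lt_of_le hi' with hk | hk
    · subst hk
      rcases Nat.eq_or_lt_of_le hii' with hi | hi
      · subst hi; exact le_rfl
      · intro y hy
        have hy' := Omega_succ_subset M₁ Rcol h hy
        rw [Omega_succ_of_le M₁ Rcol h le_rfl] at hy'
        rw [Omega_succ_of_le M₁ Rcol h (by omega)]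
        exact ih h.proj i k (by omega) le_rfl hy'
    · rw [Omega_succ_of_le M₁ Rcol h (by omega), Omega_succ_of_le M₁ Rcol h (by omega)]
      exact ih h.proj i i' hii' (by omega)

/-- Admissibility passes to the truncations. [folklore] -/
theorem admissible_castLE : ∀ (k : ℕ) (h : Hist P k), Hist.Admissible M₁ Rcol k h → ∀ (j : ℕ) (hjk : j ≤ k),
    Hist.Admissible M₁ Rcol j (fun i => h (Fin.castLE hjk i)) := by
  intro k
  induction k with
  | zero => intro h _ j hjk; have : j = 0 := by omega
            subst this; trivial
  | succ k ih =>
    intro h hh j hjk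
    rcases Nat.eq_or_lt_of_le hjk with hj | hj
    · subst hj; exact hh
    · exact ih h.proj hh.1 j (by omega)

/-- The cover of a recorded plaquette `p′ ∈ P_j(h)` of an admissible history lies in `Λ_j(h)`: inside `Ω_j(h)` and outside
`Ω_{j+1}(h)` (p1's `plaqCover_subset_Lam` at the truncation to `j + 1` passages, transported by `Omega_castLE`). [cite: Balaban1985UV3, p.273] -/
theorem plaqCover_subset_of_admissible {k : ℕ} {h : Hist P k} (hh : Hist.Admissible M₁ Rcol k h) {j : ℕ} (hj : j < k)
    {p : Plaq P j} (hp : p ∈ h ⟨j, hj⟩) {x : Site P 0} (hx : x ∈ plaqCover p) :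
    x ∈ Omega M₁ Rcol k h j ∧ x ∉ Omega M₁ Rcol k h (j + 1) := by
  have hjk : j + 1 ≤ k := hj
  set h' : Hist P (j + 1) := fun i => h (Fin.castLE hjk i) with hh'
  have hadm : Hist.Admissible M₁ Rcol (j + 1) h' := admissible_castLE M₁ Rcol k h hh (j + 1) hjk
  have hp' : p ∈ h'.last := by
    show p ∈ h (Fin.castLE hjk (Fin.last j))
    exact hp
  have hL := plaqCover_subset_Lam M₁ Rcol hadm hp' hx
  -- Lam h' j = Ω_j(h') \ Ω_{j+1}(h')
  obtain ⟨h1, h2⟩ := hL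
  constructor
  · rw [Omega_castLE M₁ Rcol k h j (by omega)]
    rw [Omega_succ_of_le M₁ Rcol h' le_rfl] at h1
    have : (fun i : Fin j => h (Fin.castLE (show j ≤ k by omega) i)) = h'.proj := by
      funext i; rfl
    rw [this]; exact h1
  · rw [Omega_castLE M₁ Rcol k h (j + 1) hjk]; exact h2

/-- **Covers of recorded plaquettes of different scales are disjoint** on an admissible history. [cite: Balaban1985UV3, p.273] -/
theorem scale_eq_of_mem_plaqCover {k : ℕ} {h : Hist P k} (hh : Hist.Admissible M₁ Rcol k h) {j j' : ℕ} (hj : j < k)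
    (hj' : j' < k) {p : Plaq P j} (hp : p ∈ h ⟨j, hj⟩) {p' : Plaq P j'} (hp' : p' ∈ h ⟨j', hj'⟩) {x : Site P 0}
    (hx : x ∈ plaqCover p) (hx' : x ∈ plaqCover p') : j = j' := by
  by_contra hne
  rcases Nat.lt_or_gt_of_ne hne with hlt | hlt
  · obtain ⟨_, h2⟩ := plaqCover_subset_of_admissible M₁ Rcol hh hj hp hx
    obtain ⟨h1, _⟩ := plaqCover_subset_of_admissible M₁ Rcol hh hj' hp' hx'
    exact h2 (Omega_antitone M₁ Rcol k h (j + 1) j' hlt hj'.le h1)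
  · obtain ⟨_, h2⟩ := plaqCover_subset_of_admissible M₁ Rcol hh hj' hp' hx'
    obtain ⟨h1, _⟩ := plaqCover_subset_of_admissible M₁ Rcol hh hj hp hx
    exact h2 (Omega_antitone M₁ Rcol k h (j' + 1) j hlt hj.le h1)

/-- The four corners, normal form: if `c = src + a e_μ + b e_ν` then `src` is recovered from `c` by subtracting. [folklore] -/
theorem corner_recover {j : ℕ} (src c : Site P j) {μ ν : Fin P.d} (hne : μ ≠ ν) (a b : ℕ)
    (h : c = fun κ => src κ + (if κ = μ then (a : ZMod (P.sitesPerDir j)) else 0) +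
      (if κ = ν then (b : ZMod (P.sitesPerDir j)) else 0)) :
    Function.update (Function.update c μ (c μ - a)) ν (c ν - b) = src := by
  subst h
  funext κ
  by_cases h1 : κ = ν
  · subst h1; simp [hne.symm]
  · rw [Function.update_of_ne h1]
    by_cases h2 : κ = μ
    · subst h2; simp [hne]
    · rw [Function.update_of_ne h2]; simp [h1, h2]

/-- **At most four scale-`j` plaquettes of a given orientation cover a given fine site** (their base points are the scale-`j` block of
the site minus `0` or `1` unit in each of the two directions). [cite: Balaban1985UV3, (69)–(70) p.273] -/
theorem card_sources_le_four {j : ℕ} (x : Site P 0) (μ ν : Fin P.d) (hμν : μ < ν) (s : Finset (Plaq P j))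
    (hs : ∀ p ∈ s, p.μ = μ ∧ p.ν = ν ∧ x ∈ plaqCover p) : s.card ≤ 4 := by
  classical
  have hne : μ ≠ ν := ne_of_lt hμν
  set c : Site P j := coarsen j x with hc
  -- the four candidates
  let cand : Fin 2 × Fin 2 → Plaq P j := fun ab =>
    ⟨Function.update (Function.update c μ (c μ - ((ab.1 : ℕ) : ZMod (P.sitesPerDir j)))) ν
        (c ν - ((ab.2 : ℕ) : ZMod (P.sitesPerDir j))), μ, ν, hμν⟩
  have hsub : s ⊆ (Finset.univ : Finset (Fin 2 × Fin 2)).image cand := by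
    intro p hp
    obtain ⟨hpμ, hpν, hx⟩ := hs p hp
    rw [Finset.mem_image]
    obtain ⟨src, pμ, pν, hpμν⟩ := p
    simp only at hpμ hpν
    simp only [plaqCover, Set.mem_setOf_eq, hpμ, hpν] at hx
    rw [← hc] at hx
    have shμ : ∀ κ, (src.shift μ) κ = src κ + (if κ = μ then 1 else 0) := fun κ => by
      rw [TorusLift.shift_apply]; split_ifs with h <;> simp [h]
    have shν : ∀ (y : Site P j) κ, (y.shift ν) κ = y κ + (if κ = ν then 1 else 0) := fun y κ => by
      rw [TorusLift.shift_apply]; split_ifs with h <;> simp [h]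
    rcases hx with h | h | h | h
    · refine ⟨(0, 0), Finset.mem_univ _, ?_⟩
      simp only [cand, Plaq.mk.injEq]
      refine ⟨corner_recover src c hne _ _ ?_, hpμ.symm, hpν.symm⟩
      rw [h]; funext κ; simp
    · refine ⟨(1, 0), Finset.mem_univ _, ?_⟩
      simp only [cand, Plaq.mk.injEq]
      refine ⟨corner_recover src c hne _ _ ?_, hpμ.symm, hpν.symm⟩
      rw [h]; funext κ; rw [shμ]; simp
    · refine ⟨(0, 1), Finset.mem_univ _, ?_⟩
      simp only [cand, Plaq.mk.injEq]
      refine ⟨corner_recover src c hne _ _ ?_, hpμ.symm, hpν.symm⟩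
      rw [h]; funext κ; rw [shν]; simp
    · refine ⟨(1, 1), Finset.mem_univ _, ?_⟩
      simp only [cand, Plaq.mk.injEq]
      refine ⟨corner_recover src c hne _ _ ?_, hpμ.symm, hpν.symm⟩
      rw [h]; funext κ; rw [shν, shμ]; simp [add_assoc]
  calc s.card ≤ ((Finset.univ : Finset (Fin 2 × Fin 2)).image cand).card := Finset.card_le_card hsub
    _ ≤ (Finset.univ : Finset (Fin 2 × Fin 2)).card := Finset.card_image_le
    _ = 4 := by simp

end Admissible

end Summit.QuantumFields.Balaban3D.Proofs.AdmissibleRegions
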